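import Summits.ABC.ABC.Theorems.CongruentialReceptacleTameLocalReceptacleDefs

/-!
# Crux `TameLocalReceptacle` (stmt-ABC-14354), line `SketchIdeator1`: the SIGN CLASH —
# every first-moment matching witness has friable C-members (a necessity lemma for `MatchingFamilies`)

Helper (`--supports stmt-ABC-14354`) of the checked skeleton `Cruxes/TameLocalReceptacle/Lines/SketchIdeator1.lean`
(lead `prover-line-stmt-ABC-14354-c3-0`, cycle 4).  The line is closed modulo the analytic stub
`stub_analyticInput : (∃ A, PinningFamilies (1/2^25) A) ∨ MatchingFamilies (1/4)`.  This file proves, in the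
exact vocabulary of `MatchingFamilies` (Defs: `oddPartC`, `mean`, `WindowBounded`, `IsBalanced`), the structural
constraint that decides where that stub lives.  No new definitions: the weight and the classes are explicit terms.

**Sign clash.**  Let `F_A` be a family of abc-triples whose `a`-member is `2^N·m` (`m ≤ M*`) and `F_B` one whose
`b`-member is `2^N·m'` (`m' ≤ M*`).  At an odd prime `q ∣ c` the C-key of a triple of `F_A` carries the partner
class `a ≡ 2^N m (mod q)`, that of a triple of `F_B` carries `a' ≡ −b' ≡ −2^N m' (mod q)`; if the two classes
coincide then `q ∣ 2^N (m + m')`, so `q ≤ 2M*` (`partnerClassesC_clash`).  Hence the weight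
`w(q; 0,0,k; r,·,·) = (k+1)·log q · (𝟙[r a C-partner class of F_A at q] − 𝟙[r a C-partner class of F_B at q])`
for `q > 2M*` (and `0` on all other keys) is window-bounded (`clashWeight_windowBounded`) and its C-odd-part is
`+Σ_{q ∣ c, q > 2M*} (v_q c + 1) log q` on `F_A` and MINUS that on `F_B` (`oddPartC_clashWeight_of_memA/B`).
If BOTH C-rows of the matching template hold against the same family `G` with slack `η` (rows 3 and 6 of
`MatchingFamilies`) then (`matching_C_rows_force_friable`) the mean rough C-mass above `2M*` over `F_A` plus that
over `F_B` is at most `2η`; `matchingFamilies_rows_force_friable_C` says the same with the hypotheses spelled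
exactly as in `MatchingFamilies` (`v₂ = N`, `M*` = the largest odd cofactor occurring).  So every witness of MF
has `2M*`-friable C-members up to window mass `2δN`: the families are forced into the friable (ternary) regime at
the scale of the special cofactor — where cell laws need a level of distribution beyond the range in print, which
is why the stub is not dischargeable inside the line (crux `NOTES.md`, cycle 4).
-/

-- `Summit.<Summit>.<Problem>` is the mandated summit-side namespace (CONVENTIONS §2); for the
-- single-conjunct summit `ABC` the two coincide, so the duplicate `ABC.ABC` is deliberate.
set_option linter.dupNamespace false

namespace Summit.ABC.ABC.Theorems.TameLocalReceptacle

open Finset Literature.NumberTheory.DiophantineGeometry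

/-! ### The clash: above `2M*` the position-C partner classes of `F_A` and `F_B` are disjoint -/

/-- **Sign clash.**  If the `a`-members of `F_A` are `2^N m` with `m ≤ M*` and the `b`-members of `F_B` are
`2^N m'` with `m' ≤ M*` (all abc-triples), then at an odd prime `q > 2M*` no residue `r` is a position-C partner
class (`a mod q` for a triple with `q ∣ c`) of both families: `2^N m ≡ −2^N m' (mod q)` would force
`q ∣ m + m' ≤ 2M*`. -/
theorem partnerClassesC_clash {N Mstar q r : ℕ} {FA FB : Finset (ℕ × ℕ × ℕ)}
    (hFA : ∀ T ∈ FA, IsABCTriple T.1 T.2.1 T.2.2 ∧ 2 ^ N ∣ T.1 ∧ T.1 / 2 ^ N ≤ Mstar)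
    (hFB : ∀ T ∈ FB, IsABCTriple T.1 T.2.1 T.2.2 ∧ 2 ^ N ∣ T.2.1 ∧ T.2.1 / 2 ^ N ≤ Mstar)
    (hq : q.Prime) (hq2 : q ≠ 2) (hqB : 2 * Mstar < q)
    (hrA : r ∈ (FA.filter (fun T => q ∣ T.2.2)).image (fun T => T.1 % q))
    (hrB : r ∈ (FB.filter (fun T => q ∣ T.2.2)).image (fun T => T.1 % q)) : False := by
  simp only [Finset.mem_image, Finset.mem_filter] at hrA hrB
  obtain ⟨⟨a, b, c⟩, ⟨hTA, hqc⟩, hra⟩ := hrA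
  obtain ⟨⟨a', b', c'⟩, ⟨hTB, hqc'⟩, hra'⟩ := hrB
  obtain ⟨⟨ha, _, _, _⟩, ⟨m, hm⟩, hma⟩ := hFA _ hTA
  obtain ⟨⟨_, hb', habc', _⟩, ⟨m', hm'⟩, hmb⟩ := hFB _ hTB
  dsimp only at hqc hqc' hra hra' ha hm hma hb' habc' hm' hmb
  have h2N : 0 < 2 ^ N := Nat.two_pow_pos N
  have hmq : a / 2 ^ N = m := by rw [hm, Nat.mul_div_cancel_left _ h2N]
  have hmq' : b' / 2 ^ N = m' := by rw [hm', Nat.mul_div_cancel_left _ h2N]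
  rw [hmq] at hma
  rw [hmq'] at hmb
  have hmpos : 0 < m := by
    rcases Nat.eq_zero_or_pos m with h0 | h0
    · rw [h0, mul_zero] at hm; omega
    · exact h0
  -- `a ≡ a' (mod q)` and `q ∣ a' + b'`, hence `q ∣ a + b' = 2^N (m + m')`
  have h1 : a ≡ a' [MOD q] := hra.trans hra'.symm
  have hqab' : q ∣ a' + b' := habc' ▸ hqc'
  have h2 : a + b' ≡ 0 [MOD q] :=
    (h1.add_right b').trans (Nat.modEq_zero_iff_dvd.2 hqab')
  have h3 : q ∣ 2 ^ N * (m + m') := by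
    have := Nat.modEq_zero_iff_dvd.1 h2
    rwa [hm, hm', ← mul_add] at this
  have hcop : Nat.Coprime q (2 ^ N) :=
    ((Nat.coprime_primes hq Nat.prime_two).2 hq2).pow_right N
  have h4 : q ∣ m + m' := hcop.dvd_of_dvd_mul_left h3
  have h5 : q ≤ m + m' := Nat.le_of_dvd (by omega) h4
  omega

/-! ### The clash weight (an explicit term) is window-bounded -/

/-- The clash weight of `(F_A, F_B)` above `B` — `(k+1)·log q·(𝟙[r ∈ classes of F_A] − 𝟙[r ∈ classes of F_B])`
on C-keys `(q; 0,0,k; r,·,·)` with `B < q`, `0` elsewhere — is bounded by the (`c₁' = 1`) upper window. -/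
theorem clashWeight_windowBounded (FA FB : Finset (ℕ × ℕ × ℕ)) (B : ℕ) :
    WindowBounded (fun q i j k r _ _ =>
      if i = 0 ∧ j = 0 ∧ B < q then
        (((k : ℕ) : ℝ) + 1) * Real.log q *
          ((if r ∈ (FA.filter (fun T => q ∣ T.2.2)).image (fun T => T.1 % q) then (1 : ℝ) else 0) -
            (if r ∈ (FB.filter (fun T => q ∣ T.2.2)).image (fun T => T.1 % q) then (1 : ℝ) else 0))
      else 0) := by
  intro q i j k r s z hq
  have hlog : 0 ≤ Real.log q := Real.log_nonneg (by exact_mod_cast hq.one_lt.le)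
  dsimp only
  by_cases h : i = 0 ∧ j = 0 ∧ B < q
  · rw [if_pos h]
    obtain ⟨hi, hj, -⟩ := h
    subst hi; subst hj
    have hk : ((0 + 0 + k : ℕ) : ℝ) = (k : ℝ) := by push_cast; ring
    rw [hk, abs_mul, abs_of_nonneg (by positivity : (0 : ℝ) ≤ ((k : ℝ) + 1) * Real.log q)]
    have hd : |(if r ∈ (FA.filter (fun T => q ∣ T.2.2)).image (fun T => T.1 % q) then (1 : ℝ) else 0) -
        (if r ∈ (FB.filter (fun T => q ∣ T.2.2)).image (fun T => T.1 % q) then (1 : ℝ) else 0)| ≤ 1 := by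
      split_ifs <;> norm_num
    calc ((k : ℝ) + 1) * Real.log q *
          |(if r ∈ (FA.filter (fun T => q ∣ T.2.2)).image (fun T => T.1 % q) then (1 : ℝ) else 0) -
            (if r ∈ (FB.filter (fun T => q ∣ T.2.2)).image (fun T => T.1 % q) then (1 : ℝ) else 0)|
        ≤ ((k : ℝ) + 1) * Real.log q * 1 := mul_le_mul_of_nonneg_left hd (by positivity)
      _ = ((k : ℝ) + 1) * Real.log q := mul_one _
  · rw [if_neg h, abs_zero]
    positivity

/-! ### Evaluating the clash weight on the two special families -/

/-- On an abc-triple, at a prime `q ∣ c` the datum is `(0, 0, v_q c; a mod q, b mod q, c' mod q)`. -/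
theorem evalAt_datum_of_dvd_c (w : RTable) {a b c q : ℕ} (h : IsABCTriple a b c) (hq : q.Prime)
    (hqc : q ∣ c) :
    evalAt w q (datum a b c q) =
      w q 0 0 (c.factorization q) (a % q) (b % q) (c / q ^ c.factorization q % q) := by
  obtain ⟨_, _, habc, hcop⟩ := h
  have hqa : ¬ q ∣ a := by
    intro hqa
    have hqb : q ∣ b := by
      have : q ∣ a + b := habc ▸ hqc
      exact (Nat.dvd_add_right hqa).1 this
    exact hq.one_lt.ne' (Nat.eq_one_of_dvd_one (hcop ▸ Nat.dvd_gcd hqa hqb))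
  have hqb : ¬ q ∣ b := by
    intro hqb
    have hqa' : q ∣ a := by
      have : q ∣ a + b := habc ▸ hqc
      exact (Nat.dvd_add_left hqb).1 this
    exact hqa hqa'
  simp only [evalAt, datum, Nat.factorization_eq_zero_of_not_dvd hqa,
    Nat.factorization_eq_zero_of_not_dvd hqb, pow_zero, Nat.div_one]

/-- On `F_A` the clash weight above `2M*` reads off exactly the rough C-mass
`Σ_{q ∣ c, q ≠ 2, 2M* < q} (v_q c + 1)·log q`. -/
theorem oddPartC_clashWeight_of_memA {N Mstar : ℕ} {FA FB : Finset (ℕ × ℕ × ℕ)}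
    (hFA : ∀ T ∈ FA, IsABCTriple T.1 T.2.1 T.2.2 ∧ 2 ^ N ∣ T.1 ∧ T.1 / 2 ^ N ≤ Mstar)
    (hFB : ∀ T ∈ FB, IsABCTriple T.1 T.2.1 T.2.2 ∧ 2 ^ N ∣ T.2.1 ∧ T.2.1 / 2 ^ N ≤ Mstar)
    {a b c : ℕ} (hT : (a, b, c) ∈ FA) :
    oddPartC (fun q i j k r _ _ =>
      if i = 0 ∧ j = 0 ∧ 2 * Mstar < q then
        (((k : ℕ) : ℝ) + 1) * Real.log q *
          ((if r ∈ (FA.filter (fun T => q ∣ T.2.2)).image (fun T => T.1 % q) then (1 : ℝ) else 0) -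
            (if r ∈ (FB.filter (fun T => q ∣ T.2.2)).image (fun T => T.1 % q) then (1 : ℝ) else 0))
      else 0) a b c
      = ∑ q ∈ (c.primeFactors.erase 2).filter (fun q => 2 * Mstar < q),
          (((c.factorization q : ℕ) : ℝ) + 1) * Real.log q := by
  have habc : IsABCTriple a b c := (hFA _ hT).1
  unfold oddPartC
  rw [Finset.sum_filter]
  refine Finset.sum_congr rfl fun q hq => ?_
  have hq2 : q ≠ 2 := (Finset.mem_erase.1 hq).1
  have hqc : q ∈ c.primeFactors := (Finset.mem_erase.1 hq).2
  have hqp : q.Prime := Nat.prime_of_mem_primeFactors hqc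
  have hqdvd : q ∣ c := Nat.dvd_of_mem_primeFactors hqc
  rw [evalAt_datum_of_dvd_c _ habc hqp hqdvd]
  have hmemA : a % q ∈ (FA.filter (fun T => q ∣ T.2.2)).image (fun T => T.1 % q) := by
    simp only [Finset.mem_image, Finset.mem_filter]
    exact ⟨(a, b, c), ⟨hT, hqdvd⟩, rfl⟩
  simp only [true_and]
  split_ifs with hB hmemB
  · exact (partnerClassesC_clash hFA hFB hqp hq2 hB hmemA hmemB).elim
  · ring
  · rfl

/-- On `F_B` the clash weight above `2M*` reads off exactly MINUS the rough C-mass. -/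
theorem oddPartC_clashWeight_of_memB {N Mstar : ℕ} {FA FB : Finset (ℕ × ℕ × ℕ)}
    (hFA : ∀ T ∈ FA, IsABCTriple T.1 T.2.1 T.2.2 ∧ 2 ^ N ∣ T.1 ∧ T.1 / 2 ^ N ≤ Mstar)
    (hFB : ∀ T ∈ FB, IsABCTriple T.1 T.2.1 T.2.2 ∧ 2 ^ N ∣ T.2.1 ∧ T.2.1 / 2 ^ N ≤ Mstar)
    {a b c : ℕ} (hT : (a, b, c) ∈ FB) :
    oddPartC (fun q i j k r _ _ =>
      if i = 0 ∧ j = 0 ∧ 2 * Mstar < q then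
        (((k : ℕ) : ℝ) + 1) * Real.log q *
          ((if r ∈ (FA.filter (fun T => q ∣ T.2.2)).image (fun T => T.1 % q) then (1 : ℝ) else 0) -
            (if r ∈ (FB.filter (fun T => q ∣ T.2.2)).image (fun T => T.1 % q) then (1 : ℝ) else 0))
      else 0) a b c
      = - ∑ q ∈ (c.primeFactors.erase 2).filter (fun q => 2 * Mstar < q),
          (((c.factorization q : ℕ) : ℝ) + 1) * Real.log q := by
  have habc : IsABCTriple a b c := (hFB _ hT).1
  unfold oddPartC
  rw [Finset.sum_filter, ← Finset.sum_neg_distrib]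
  refine Finset.sum_congr rfl fun q hq => ?_
  have hq2 : q ≠ 2 := (Finset.mem_erase.1 hq).1
  have hqc : q ∈ c.primeFactors := (Finset.mem_erase.1 hq).2
  have hqp : q.Prime := Nat.prime_of_mem_primeFactors hqc
  have hqdvd : q ∣ c := Nat.dvd_of_mem_primeFactors hqc
  rw [evalAt_datum_of_dvd_c _ habc hqp hqdvd]
  have hmemB : a % q ∈ (FB.filter (fun T => q ∣ T.2.2)).image (fun T => T.1 % q) := by
    simp only [Finset.mem_image, Finset.mem_filter]
    exact ⟨(a, b, c), ⟨hT, hqdvd⟩, rfl⟩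
  simp only [true_and]
  split_ifs with hB hmemA
  · exact (partnerClassesC_clash hFA hFB hqp hq2 hB hmemA hmemB).elim
  · ring
  · simp

/-! ### The necessity lemma -/

/-- **Matching in both C-rows forces friable C-members.**  If the C-position odd parts of `F_A`
(`a = 2^N m`, `m ≤ M*`) and of `F_B` (`b = 2^N m'`, `m' ≤ M*`) both match those of one family `G` within `η`
for every window-bounded weight (rows 3 and 6 of the `MatchingFamilies` template), then the C-members of
`F_A ∪ F_B` carry, on average, at most `2η` window mass at primes above `2M*`:
`mean_{F_A} Σ_{q ∣ c, 2M* < q} (v_q c + 1) log q + mean_{F_B} (same) ≤ 2η`.  No hypothesis on `G`. -/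
theorem matching_C_rows_force_friable {N Mstar : ℕ} {η : ℝ} {FA FB G : Finset (ℕ × ℕ × ℕ)}
    (hFA : ∀ T ∈ FA, IsABCTriple T.1 T.2.1 T.2.2 ∧ 2 ^ N ∣ T.1 ∧ T.1 / 2 ^ N ≤ Mstar)
    (hFB : ∀ T ∈ FB, IsABCTriple T.1 T.2.1 T.2.2 ∧ 2 ^ N ∣ T.2.1 ∧ T.2.1 / 2 ^ N ≤ Mstar)
    (hA : ∀ w : RTable, WindowBounded w →
      |mean FA (fun T => oddPartC w T.1 T.2.1 T.2.2) - mean G (fun T => oddPartC w T.1 T.2.1 T.2.2)| ≤ η)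
    (hB : ∀ w : RTable, WindowBounded w →
      |mean FB (fun T => oddPartC w T.1 T.2.1 T.2.2) - mean G (fun T => oddPartC w T.1 T.2.1 T.2.2)| ≤ η) :
    mean FA (fun T => ∑ q ∈ (T.2.2.primeFactors.erase 2).filter (fun q => 2 * Mstar < q),
        (((T.2.2.factorization q : ℕ) : ℝ) + 1) * Real.log q)
      + mean FB (fun T => ∑ q ∈ (T.2.2.primeFactors.erase 2).filter (fun q => 2 * Mstar < q),
        (((T.2.2.factorization q : ℕ) : ℝ) + 1) * Real.log q)
      ≤ 2 * η := by
  -- the clash weight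
  set w : RTable := fun q i j k r _ _ =>
      if i = 0 ∧ j = 0 ∧ 2 * Mstar < q then
        (((k : ℕ) : ℝ) + 1) * Real.log q *
          ((if r ∈ (FA.filter (fun T => q ∣ T.2.2)).image (fun T => T.1 % q) then (1 : ℝ) else 0) -
            (if r ∈ (FB.filter (fun T => q ∣ T.2.2)).image (fun T => T.1 % q) then (1 : ℝ) else 0))
      else 0 with hw_def
  have hw : WindowBounded w := clashWeight_windowBounded FA FB (2 * Mstar)
  have hA' := hA w hw
  have hB' := hB w hw
  have eA : mean FA (fun T => oddPartC w T.1 T.2.1 T.2.2)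
      = mean FA (fun T => ∑ q ∈ (T.2.2.primeFactors.erase 2).filter (fun q => 2 * Mstar < q),
          (((T.2.2.factorization q : ℕ) : ℝ) + 1) * Real.log q) := by
    unfold mean
    congr 1
    refine Finset.sum_congr rfl fun T hT => ?_
    obtain ⟨a, b, c⟩ := T
    exact oddPartC_clashWeight_of_memA hFA hFB hT
  have eB : mean FB (fun T => oddPartC w T.1 T.2.1 T.2.2)
      = - mean FB (fun T => ∑ q ∈ (T.2.2.primeFactors.erase 2).filter (fun q => 2 * Mstar < q),
          (((T.2.2.factorization q : ℕ) : ℝ) + 1) * Real.log q) := by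
    unfold mean
    rw [← neg_div, ← Finset.sum_neg_distrib]
    congr 1
    refine Finset.sum_congr rfl fun T hT => ?_
    obtain ⟨a, b, c⟩ := T
    exact oddPartC_clashWeight_of_memB hFA hFB hT
  rw [eA] at hA'
  rw [eB] at hB'
  have h1 := (abs_le.1 hA').2
  have h2 := (abs_le.1 hB').1
  linarith

/-- **The same in the exact vocabulary of `MatchingFamilies`.**  For families `F_A`, `F_B` of `κ`-balanced
triples with `v₂(a) = N` on `F_A` and `v₂(b) = N` on `F_B`, any `G`, and slack `δ·N` in the two C-rows
(rows 3 and 6 of `MatchingFamilies κ`), writing `M*` for the largest odd cofactor `a/2^N` (`F_A`), `b/2^N`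
(`F_B`) that occurs: the mean rough C-mass above `2M*` over `F_A` plus that over `F_B` is at most `2δN`.
In words: every witness of the matching hypothesis has its C-members `2M*`-friable up to window mass `2δN`
— the witness families are forced into the friable (ternary) regime at the scale of the special cofactor. -/
theorem matchingFamilies_rows_force_friable_C {κ δ : ℝ} {N : ℕ} {FA FB G : Finset (ℕ × ℕ × ℕ)}
    (hFA : ∀ T ∈ FA, IsBalanced κ T.1 T.2.1 T.2.2 ∧ T.1.factorization 2 = N)
    (hFB : ∀ T ∈ FB, IsBalanced κ T.1 T.2.1 T.2.2 ∧ T.2.1.factorization 2 = N)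
    (hA : ∀ w : RTable, WindowBounded w →
      |mean FA (fun T => oddPartC w T.1 T.2.1 T.2.2) - mean G (fun T => oddPartC w T.1 T.2.1 T.2.2)|
        ≤ δ * N)
    (hB : ∀ w : RTable, WindowBounded w →
      |mean FB (fun T => oddPartC w T.1 T.2.1 T.2.2) - mean G (fun T => oddPartC w T.1 T.2.1 T.2.2)|
        ≤ δ * N) :
    mean FA (fun T => ∑ q ∈ (T.2.2.primeFactors.erase 2).filter
        (fun q => 2 * ((FA.image fun T => T.1 / 2 ^ N) ∪ (FB.image fun T => T.2.1 / 2 ^ N)).sup id < q),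
        (((T.2.2.factorization q : ℕ) : ℝ) + 1) * Real.log q)
      + mean FB (fun T => ∑ q ∈ (T.2.2.primeFactors.erase 2).filter
        (fun q => 2 * ((FA.image fun T => T.1 / 2 ^ N) ∪ (FB.image fun T => T.2.1 / 2 ^ N)).sup id < q),
        (((T.2.2.factorization q : ℕ) : ℝ) + 1) * Real.log q)
      ≤ 2 * (δ * N) := by
  set Mstar := ((FA.image fun T => T.1 / 2 ^ N) ∪ (FB.image fun T => T.2.1 / 2 ^ N)).sup id with hM
  have hFA' : ∀ T ∈ FA, IsABCTriple T.1 T.2.1 T.2.2 ∧ 2 ^ N ∣ T.1 ∧ T.1 / 2 ^ N ≤ Mstar := by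
    intro T hT
    obtain ⟨⟨habc, -, -⟩, hN⟩ := hFA T hT
    refine ⟨habc, hN ▸ Nat.ordProj_dvd T.1 2, ?_⟩
    have : T.1 / 2 ^ N ∈ (FA.image fun T => T.1 / 2 ^ N) ∪ (FB.image fun T => T.2.1 / 2 ^ N) :=
      Finset.mem_union_left _ (Finset.mem_image_of_mem _ hT)
    exact Finset.le_sup (f := id) this
  have hFB' : ∀ T ∈ FB, IsABCTriple T.1 T.2.1 T.2.2 ∧ 2 ^ N ∣ T.2.1 ∧ T.2.1 / 2 ^ N ≤ Mstar := by
    intro T hT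
    obtain ⟨⟨habc, -, -⟩, hN⟩ := hFB T hT
    refine ⟨habc, hN ▸ Nat.ordProj_dvd T.2.1 2, ?_⟩
    have : T.2.1 / 2 ^ N ∈ (FA.image fun T => T.1 / 2 ^ N) ∪ (FB.image fun T => T.2.1 / 2 ^ N) :=
      Finset.mem_union_right _ (Finset.mem_image_of_mem _ hT)
    exact Finset.le_sup (f := id) this
  exact matching_C_rows_force_friable hFA' hFB' hA hB

/-- **Registered form** (stub `stub_matchingSignClash` of stmt-ABC-14354, uncurried, one line): matching in both
C-rows of the `MatchingFamilies` template forces the C-members of `F_A ∪ F_B` to be `2M*`-friable up to mean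
window mass `2η` — see `matching_C_rows_force_friable` for the curried form and the proof. -/
theorem stub_matchingSignClash : ∀ (N Mstar : ℕ) (η : ℝ) (FA FB G : Finset (ℕ × ℕ × ℕ)), (∀ T ∈ FA, IsABCTriple T.1 T.2.1 T.2.2 ∧ 2 ^ N ∣ T.1 ∧ T.1 / 2 ^ N ≤ Mstar) → (∀ T ∈ FB, IsABCTriple T.1 T.2.1 T.2.2 ∧ 2 ^ N ∣ T.2.1 ∧ T.2.1 / 2 ^ N ≤ Mstar) → (∀ w : RTable, WindowBounded w → |mean FA (fun T => oddPartC w T.1 T.2.1 T.2.2) - mean G (fun T => oddPartC w T.1 T.2.1 T.2.2)| ≤ η) → (∀ w : RTable, WindowBounded w → |mean FB (fun T => oddPartC w T.1 T.2.1 T.2.2) - mean G (fun T => oddPartC w T.1 T.2.1 T.2.2)| ≤ η) → mean FA (fun T => ∑ q ∈ (T.2.2.primeFactors.erase 2).filter (fun q => 2 * Mstar < q), (((T.2.2.factorization q : ℕ) : ℝ) + 1) * Real.log q) + mean FB (fun T => ∑ q ∈ (T.2.2.primeFactors.erase 2).filter (fun q => 2 * Mstar < q), (((T.2.2.factorization q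 : ℕ) : ℝ) + 1) * Real.log q) ≤ 2 * η :=
  fun _ _ _ _ _ _ hFA hFB hA hB => matching_C_rows_force_friable hFA hFB hA hB

end Summit.ABC.ABC.Theorems.TameLocalReceptacle
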